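import Summits.BirchSwinnertonDyer.BirchSwinnertonDyer.Theorems.ResidualThetaTransportAtTwoResidualSignedLambdaLowerCMAtTwoCoindShapiroOfFun
import Summits.BirchSwinnertonDyer.BirchSwinnertonDyer.Theorems.ThetaPartnerAtTwoSignedMainConjectureCMTwoRankZeroPTDeepLocalTransport
import Summits.BirchSwinnertonDyer.BirchSwinnertonDyer.Theorems.ThetaPartnerAtTwoSignedMainConjectureCMTwoRankZeroPTDeepAdmissibleTransport
import Summits.BirchSwinnertonDyer.BirchSwinnertonDyer.Theorems.ThetaPartnerAtTwoSignedMainConjectureCMTwoRankZeroPTDeepSelmerTransport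
import Literature.NumberTheory.EllipticCurves.CyclotomicLayerRhoTatePairingPk
import HarnessLib

/-!
# Shapiro TRANSPORTS for `Maps(Γ_ℚ ⧸ Γ_n, A_ρ[N])` — the `A_ρ[N]`- / `ρM`-twins of the TP2 bricks (E1a/d) `…PTDeepAdmissibleTransport`,
# (E1b/c) `…PTDeepLocalTransport` and the `Ψ`-transports of `…PTDeepSelmerTransport`: from LOCAL conditions on the global Shapiro lift
# `Sh c ∈ H¹(ℚ, Maps(Γ_ℚ ⧸ Γ_n, ·))` (unramified / locally trivial / through the duality `Ψ`) to the LAYER class `c ∈ H¹(Γ_n, ·)`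

Route `ResidualThetaTransportAtTwo` (RTT), crux RSL_g `ResidualSignedLambdaLowerCMAtTwo` (stmt-BirchSwinnertonDyer-22608); seat
`prover-bsd-wall-tp2-p2x` g17 (`--supports 22608 --as helper`, closes nothing). THEOREMS ONLY (no definition, no named fact, no instance
declaration, no `sorry`). STUB-PLAN rev 16 S66 (2)/(4) «dictionaries» of the deep-half stubs (`stub_deepHalfAwayTwo` S4₀, `stub_deepHalfAtTwoStrict`
S4₂; Q67): the ONE `SelmerComplement` call per level `(n, k)` on `ρc := Maps(Γ_ℚ ⧸ Γ_n, A_ρ[2^k])` produces a GLOBAL class with local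
conditions; these are read back on the LAYER class by the lemmas below. All engines are the TP2 files' GENERIC theorems
(`isUnramifiedAt_coind`, `resLe_inertia_eq_zero_of_localization_shapiroLift_mem`, `exists_apply_conj_eq_of_res_shapiroLift_eq_zero`,
`bijective_cohomologyMap_of_bijective`, `coindTateDualHom_bijective`) + `CoindShapiroOfFun.bijective_pairingHomOfFun_flip`.

* §1 `isUnramifiedAt_cofreeTorsionGaloisModule` — `A_ρ[N]` is unramified at `w` when `ρ` is (`ρ(σ) = 1` on `I_𝔓`:
  `smul_cofreeMk` / `fracRepresentation_apply_apply`); `isUnramifiedAt_coind_cofreeTorsionGaloisModule_layerSubgroup` — so is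
  `Maps(Γ_ℚ ⧸ Γ_n, A_ρ[N])` at `w ∤ p` (`I_𝔓 ≤ Γ_n`).
* §2 (E1a/d) `resLe_inertia_layer_eq_zero_of_localization_shapiroLift_mem`, **`admissible_of_forall_localization_shapiroLift_mem`** — if
  `loc_w (Sh c)` is UNRAMIFIED at every `w ∉ S'` (a place set containing the places over `p` and the ramified places of `ρ`), then `c` is
  ADMISSIBLE: `∀ w ∉ S', ∀ 𝔓 ∣ w, resLe … (Γ_n ⊓ I_𝔓 ≤ Γ_n) 1 c = 0` (the currency of `ThetaTransport.admissible_*`, file `…CofreeAdmissible.lean`).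
* §3 (E1b/c) `resOfLe_range_conjH1_eq_zero_of_res_shapiroLift_eq_zero`, **`resOfLe_decomp_conjH1_eq_zero_of_localization_shapiroLift_eq_zero`**,
  `resOfLe_decompInf_conjH1_eq_zero_of_localization_shapiroLift_eq_zero` — if `loc_w (Sh c) = 0` (finite or infinite `w`) then every conjugate
  `conj_σ c` dies on `Γ_n ∩ D_w` (Greenberg–Vatsal dialect `resOfLe` / `conjH1` / `decomp`).
* §4 (`Ψ`-transports, GENERIC finite discrete `M` with non-degenerate `e : M × M → μ_N`, `N • M = 0`, any open `U`):
  `localization_eq_zero_of_localization_coindTateDual_eq_zero` (`loc_w (H¹(Ψ) X) = 0 ⟹ loc_w X = 0`, every place `w`),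
  `localization_mem_unramifiedSubgroup_of_coindTateDual` (`loc_w (H¹(Ψ) X)` unramified ⟹ `loc_w X` unramified).

References: [NeukirchSchmidtWingberg2008] I §5 (1.5.2), I §6 Prop. (1.6.4); [MilneADT2006] I Cor. 2.3, Thm. 2.6, I §4; [SerreGaloisCohomology1997]
I §2.5; [Greenberg1989] §1 p. 98; [Washington1997] Prop. 13.2; [EmertonPollackWeston2006] §3.1. BSD is not proved by any of this; RSL_g is not
proved here.
-/

set_option autoImplicit false
-- the Theorems namespace of this sub repeats the summit name by design (D-0017 nested layout)
set_option linter.dupNamespace false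

noncomputable section

open scoped Classical NumberField Pointwise

namespace Summit.BirchSwinnertonDyer.BirchSwinnertonDyer.Theorems

namespace ThetaTransport.ShapiroTransport

open CategoryTheory Field NumberField IsDedekindDomain
  Literature.NumberTheory.EllipticCurves Literature.NumberTheory.EllipticCurves.GreenbergSelmer
  Literature.NumberTheory.GaloisRepresentations Literature.NumberTheory.GaloisRepresentations.DiscreteGaloisModule
  Literature.NumberTheory.GaloisCohomology ZpExtension
  SignedLowerOffTwo.PTDeep

/-! ## §1 `A_ρ[N]` and `Maps(Γ_ℚ ⧸ Γ_n, A_ρ[N])` are unramified where `ρ` is (away from `p`) -/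

section Unramified

variable {p : ℕ} [Fact p.Prime] (S : Set (PadicAlgCl p)) {d : ℕ} (ρ : FramedGaloisRep ℚ ↥(padicCoeffIntegers S) d)

/-- **`A_ρ[N]` is unramified at `w` when `ρ` is**: an element `σ ∈ I_𝔓`, `𝔓 ∣ w`, has `ρ(σ) = 1`, hence acts trivially on `A_ρ = Fⁿ/𝒪ⁿ`
(`σ • (x mod 𝒪ⁿ) = (ρ(σ)x) mod 𝒪ⁿ`, `smul_cofreeMk`) and on its `N`-torsion. [cite: EmertonPollackWeston2006, §3.1 (arXiv:math/0404484 p. 17)]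
[cite: SerreGaloisCohomology1997, I §2.1] -/
theorem isUnramifiedAt_cofreeTorsionGaloisModule (N : ℤ) {w : HeightOneSpectrum (𝓞 ℚ)} (hρ : ρ.IsUnramifiedAt w) :
    GaloisRep.IsUnramifiedAt w (cofreeTorsionGaloisModule S ρ N) := by
  intro 𝔓 h𝔓 σ hσ
  refine LinearMap.ext fun a ↦ Subtype.ext ?_
  rw [cofreeTorsionGaloisModule_apply_apply, Module.End.one_apply,
    Literature.NumberTheory.EllipticCurves.AddSubgroup.torsionBy.coe_smul]
  obtain ⟨x, hx⟩ := cofreeMk_surjective (padicCoeffField S) ρ (a : Cofree ρ ↥(padicCoeffField S))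
  rw [← hx, smul_cofreeMk, fracRepresentation_apply_apply, hρ 𝔓 h𝔓 σ hσ, Units.val_one,
    Matrix.map_one _ (map_zero _) (map_one _), Matrix.one_mulVec]

/-- **`Maps(Γ_ℚ ⧸ Γ_n, A_ρ[N])` is unramified at every `w ∤ p` where `ρ` is unramified** (§1 + `isUnramifiedAt_coind` + `I_𝔓 ≤ Γ_n`,
Washington 13.2). [cite: NeukirchSchmidtWingberg2008, I §6 Prop. (1.6.4)] [cite: Washington1997, Prop. 13.2] -/
theorem isUnramifiedAt_coind_cofreeTorsionGaloisModule_layerSubgroup (κ : ZpExtension ℚ p) (N : ℤ) (n : ℕ)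
    [Fintype (absoluteGaloisGroup ℚ ⧸ κ.layerSubgroup n)] {w : HeightOneSpectrum (𝓞 ℚ)} (hpw : (p : 𝓞 ℚ) ∉ w.asIdeal)
    (hρ : ρ.IsUnramifiedAt w) :
    GaloisRep.IsUnramifiedAt w ((cofreeTorsionGaloisModule S ρ N).coind (κ.layerSubgroup n) (κ.isOpen_layerSubgroup n)) :=
  isUnramifiedAt_coind _ _ _ (isUnramifiedAt_cofreeTorsionGaloisModule S ρ N hρ) (inertia_le_layerSubgroup κ n hpw)

end Unramified

/-! ## §2 (E1a/d) Unramified localisation of the Shapiro lift ⟹ the layer class is admissible -/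

section Admissible

variable {p : ℕ} [Fact p.Prime] (S : Set (PadicAlgCl p)) {d : ℕ} (ρ : FramedGaloisRep ℚ ↥(padicCoeffIntegers S) d)
  (κ : ZpExtension ℚ p) (N : ℤ) (n : ℕ) [Fintype (absoluteGaloisGroup ℚ ⧸ κ.layerSubgroup n)]
  {s : absoluteGaloisGroup ℚ ⧸ κ.layerSubgroup n → absoluteGaloisGroup ℚ}
  (hs : ∀ x : absoluteGaloisGroup ℚ ⧸ κ.layerSubgroup n, (s x : absoluteGaloisGroup ℚ ⧸ κ.layerSubgroup n) = x)
  (hs1 : s ((1 : absoluteGaloisGroup ℚ) : absoluteGaloisGroup ℚ ⧸ κ.layerSubgroup n) = 1)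

/-- **The layer form of the unramified transport for `A_ρ[N]` at `w ∤ p`, `ρ` unramified at `w`**: if the Shapiro lift of
`c ∈ H¹(Γ_n, A_ρ[N])` localises at `w` into `H¹_ur(ℚ_w, Maps(Γ_ℚ ⧸ Γ_n, A_ρ[N]))`, then `res_{Γ_n ∩ I_𝔓} c = 0` for every `𝔓 ∣ w`.
[cite: NeukirchSchmidtWingberg2008, I §6 Prop. (1.6.4)] [cite: MilneADT2006, Ch. I §4] -/
theorem resLe_inertia_layer_eq_zero_of_localization_shapiroLift_mem {w : HeightOneSpectrum (𝓞 ℚ)} (hpw : (p : 𝓞 ℚ) ∉ w.asIdeal)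
    (hρ : ρ.IsUnramifiedAt w) (c : H1 (cofreeTorsionGaloisModule S ρ N) (κ.layerSubgroup n))
    (hc : galoisCohomology.localization
        ((cofreeTorsionGaloisModule S ρ N).coind (κ.layerSubgroup n) (κ.isOpen_layerSubgroup n)) (Sum.inr w) 1
        (shapiroLift (cofreeTorsionGaloisModule S ρ N).toTopRep (κ.layerSubgroup n) (κ.isOpen_layerSubgroup n) hs hs1 c) ∈
      unramifiedSubgroup (GaloisRep.toLocal w
        ((cofreeTorsionGaloisModule S ρ N).coind (κ.layerSubgroup n) (κ.isOpen_layerSubgroup n))) 1) :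
    ∀ 𝔓 ∈ w.primesAbove,
      resLe (cofreeTorsionGaloisModule S ρ N).toTopRep
        (inf_le_left : κ.layerSubgroup n ⊓ 𝔓.inertia (absoluteGaloisGroup ℚ) ≤ κ.layerSubgroup n) 1 c = 0 :=
  fun _ h𝔓 ↦ resLe_inertia_eq_zero_of_localization_shapiroLift_mem _ _ _ hs hs1
    (isUnramifiedAt_coind_cofreeTorsionGaloisModule_layerSubgroup S ρ κ N n hpw hρ) c hc h𝔓

/-- **(E1a/d) for `A_ρ[N]`.** Let `S'` be a place set outside which the places are prime to `p` and `ρ` is unramified (for the RSL_g habitat: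
`S' ⊇ {v : ℓ_v ∣ 2M} ∪ S₀`). If for every `w ∉ S'` the localisation at `w` of `Sh c` lies in the unramified subgroup, then `c ∈ H¹(Γ_n, A_ρ[N])` is
ADMISSIBLE outside `S'`: `∀ w ∉ S', ∀ 𝔓 ∣ w, resLe … (Γ_n ⊓ I_𝔓 ≤ Γ_n) 1 c = 0` (the currency of `ThetaTransport.admissible_layerCores`,
`admissible_finite`, …). [cite: NeukirchSchmidtWingberg2008, I §6 Prop. (1.6.4)] [cite: MilneADT2006, Ch. I §4] -/
theorem admissible_of_forall_localization_shapiroLift_mem {S' : Set (HeightOneSpectrum (𝓞 ℚ))}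
    (hS : ∀ w : HeightOneSpectrum (𝓞 ℚ), w ∉ S' → (p : 𝓞 ℚ) ∉ w.asIdeal ∧ ρ.IsUnramifiedAt w)
    (c : H1 (cofreeTorsionGaloisModule S ρ N) (κ.layerSubgroup n))
    (hc : ∀ w : HeightOneSpectrum (𝓞 ℚ), w ∉ S' →
      galoisCohomology.localization
          ((cofreeTorsionGaloisModule S ρ N).coind (κ.layerSubgroup n) (κ.isOpen_layerSubgroup n)) (Sum.inr w) 1
          (shapiroLift (cofreeTorsionGaloisModule S ρ N).toTopRep (κ.layerSubgroup n) (κ.isOpen_layerSubgroup n) hs hs1 c) ∈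
        unramifiedSubgroup (GaloisRep.toLocal w
          ((cofreeTorsionGaloisModule S ρ N).coind (κ.layerSubgroup n) (κ.isOpen_layerSubgroup n))) 1) :
    ∀ w : HeightOneSpectrum (𝓞 ℚ), w ∉ S' → ∀ 𝔓 ∈ w.primesAbove,
      resLe (cofreeTorsionGaloisModule S ρ N).toTopRep
        (inf_le_left : κ.layerSubgroup n ⊓ 𝔓.inertia (absoluteGaloisGroup ℚ) ≤ κ.layerSubgroup n) 1 c = 0 :=
  fun w hw 𝔓 h𝔓 ↦ resLe_inertia_layer_eq_zero_of_localization_shapiroLift_mem S ρ κ N n hs hs1 (hS w hw).1 (hS w hw).2 c (hc w hw) 𝔓 h𝔓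

end Admissible

/-! ## §3 (E1b/c) Local vanishing of the Shapiro lift ⟹ every conjugate of the layer class dies on `Γ_n ∩ D_w` -/

section Local

variable {p : ℕ} [Fact p.Prime] (S : Set (PadicAlgCl p)) {d : ℕ} (ρ : FramedGaloisRep ℚ ↥(padicCoeffIntegers S) d) (N : ℤ)
  (κ : ZpExtension ℚ p) (n : ℕ) [Fintype (absoluteGaloisGroup ℚ ⧸ κ.layerSubgroup n)]
  {s : absoluteGaloisGroup ℚ ⧸ κ.layerSubgroup n → absoluteGaloisGroup ℚ}
  (hs : ∀ x : absoluteGaloisGroup ℚ ⧸ κ.layerSubgroup n, (s x : absoluteGaloisGroup ℚ ⧸ κ.layerSubgroup n) = x)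
  (hs1 : s ((1 : absoluteGaloisGroup ℚ) : absoluteGaloisGroup ℚ ⧸ κ.layerSubgroup n) = 1)

/-- The common step of (E1b)/(E1c) for `A_ρ[N]`: from the vanishing of the restriction of `Sh c` to `Γ_E` to the vanishing of
`res_{Γ_n ∩ D_E} (conj_σ c)` for every `σ`, `D_E` the image of `Γ_E → Γ_ℚ` (Greenberg–Vatsal dialect `resOfLe` / `conjH1` on
`subgroupH1 Γ_n A_ρ[N] = H1 (cofreeTorsionGaloisModule S ρ N) Γ_n`). [cite: SerreGaloisCohomology1997, I §2.5]
[cite: NeukirchSchmidtWingberg2008, I §6 Prop. (1.6.4)] -/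
theorem resOfLe_range_conjH1_eq_zero_of_res_shapiroLift_eq_zero (E : Type) [Field E] [Algebra ℚ E]
    (c : H1 (cofreeTorsionGaloisModule S ρ N) (κ.layerSubgroup n))
    (h0 : galoisCohomology.res ((cofreeTorsionGaloisModule S ρ N).coind (κ.layerSubgroup n) (κ.isOpen_layerSubgroup n)) E 1
      (shapiroLift (cofreeTorsionGaloisModule S ρ N).toTopRep (κ.layerSubgroup n) (κ.isOpen_layerSubgroup n) hs hs1 c) = 0)
    (σ : absoluteGaloisGroup ℚ) :
    resOfLe ↥(AddSubgroup.torsionBy (Cofree ρ ↥(padicCoeffField S)) N)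
        (inf_le_left : κ.layerSubgroup n ⊓ (absGaloisRestrict ℚ E).toMonoidHom.range ≤ κ.layerSubgroup n)
      (conjH1 (κ.layerSubgroup n) ↥(AddSubgroup.torsionBy (Cofree ρ ↥(padicCoeffField S)) N) σ
        (c : subgroupH1 (κ.layerSubgroup n) ↥(AddSubgroup.torsionBy (Cofree ρ ↥(padicCoeffField S)) N))) = 0 := by
  obtain ⟨z, rfl⟩ := oneCocycleClass_surjective (subgroupRep (cofreeTorsionGaloisModule S ρ N).toTopRep (κ.layerSubgroup n)) c
  obtain ⟨a, ha⟩ := exists_apply_conj_eq_of_res_shapiroLift_eq_zero (cofreeTorsionGaloisModule S ρ N) (κ.layerSubgroup n)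
    (κ.isOpen_layerSubgroup n) hs hs1 E z h0 σ
  change resOfLe ↥(AddSubgroup.torsionBy (Cofree ρ ↥(padicCoeffField S)) N) _
    (conjH1 (κ.layerSubgroup n) ↥(AddSubgroup.torsionBy (Cofree ρ ↥(padicCoeffField S)) N) σ
      (oneCocycleClass (discreteTopRep (κ.layerSubgroup n) ↥(AddSubgroup.torsionBy (Cofree ρ ↥(padicCoeffField S)) N)) z)) = 0
  rw [CocycleCriteria.conjH1_oneCocycleClass_mem_ker_resOfLe_iff]
  refine ⟨a, fun x ↦ ?_⟩
  have hmem : σ * ((subgroupConj (κ.layerSubgroup n) σ (Subgroup.inclusion inf_le_left x) : κ.layerSubgroup n) :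
      absoluteGaloisGroup ℚ) * σ⁻¹ = (x : absoluteGaloisGroup ℚ) := by
    rw [subgroupConj_apply_coe, Subgroup.coe_inclusion]; group
  have h := ha (subgroupConj (κ.layerSubgroup n) σ (Subgroup.inclusion inf_le_left x)) (by rw [hmem]; exact x.2.2)
  rw [hmem] at h
  exact h

/-- **(E1b) for `A_ρ[N]` — FINITE places.** If the localisation at the finite place `w` of the Shapiro lift `Sh c` of
`c ∈ H¹(Γ_n, A_ρ[N])` VANISHES, then for every `σ ∈ Γ_ℚ` the conjugate class `conj_σ c` dies on `Γ_n ∩ D_w` (`GreenbergSelmer.decomp w`).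
[cite: SerreGaloisCohomology1997, I §2.5] [cite: Greenberg1989, §1 p. 98 (3)] -/
theorem resOfLe_decomp_conjH1_eq_zero_of_localization_shapiroLift_eq_zero (w : HeightOneSpectrum (𝓞 ℚ))
    (c : H1 (cofreeTorsionGaloisModule S ρ N) (κ.layerSubgroup n))
    (h0 : galoisCohomology.localization ((cofreeTorsionGaloisModule S ρ N).coind (κ.layerSubgroup n) (κ.isOpen_layerSubgroup n))
      (Sum.inr w) 1 (shapiroLift (cofreeTorsionGaloisModule S ρ N).toTopRep (κ.layerSubgroup n) (κ.isOpen_layerSubgroup n) hs hs1 c) = 0)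
    (σ : absoluteGaloisGroup ℚ) :
    resOfLe ↥(AddSubgroup.torsionBy (Cofree ρ ↥(padicCoeffField S)) N)
        (inf_le_left : κ.layerSubgroup n ⊓ GreenbergSelmer.decomp w ≤ κ.layerSubgroup n)
      (conjH1 (κ.layerSubgroup n) ↥(AddSubgroup.torsionBy (Cofree ρ ↥(padicCoeffField S)) N) σ
        (c : subgroupH1 (κ.layerSubgroup n) ↥(AddSubgroup.torsionBy (Cofree ρ ↥(padicCoeffField S)) N))) = 0 :=
  resOfLe_range_conjH1_eq_zero_of_res_shapiroLift_eq_zero S ρ N κ n hs hs1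
    (NumberField.Place.Completion (Sum.inr w : NumberField.Place ℚ)) c h0 σ

/-- **(E1c) for `A_ρ[N]` — INFINITE places**: if `loc_w (Sh c) = 0` at the infinite place `w` then `conj_σ c` dies on `Γ_n ∩ D_w`
(`GreenbergSelmer.decompInf w`) for every `σ`. [cite: SerreGaloisCohomology1997, I §2.5] [cite: Greenberg1989, §1 p. 98 (3)] -/
theorem resOfLe_decompInf_conjH1_eq_zero_of_localization_shapiroLift_eq_zero (w : InfinitePlace ℚ)
    (c : H1 (cofreeTorsionGaloisModule S ρ N) (κ.layerSubgroup n))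
    (h0 : galoisCohomology.localization ((cofreeTorsionGaloisModule S ρ N).coind (κ.layerSubgroup n) (κ.isOpen_layerSubgroup n))
      (Sum.inl w) 1 (shapiroLift (cofreeTorsionGaloisModule S ρ N).toTopRep (κ.layerSubgroup n) (κ.isOpen_layerSubgroup n) hs hs1 c) = 0)
    (σ : absoluteGaloisGroup ℚ) :
    resOfLe ↥(AddSubgroup.torsionBy (Cofree ρ ↥(padicCoeffField S)) N)
        (inf_le_left : κ.layerSubgroup n ⊓ GreenbergSelmer.decompInf w ≤ κ.layerSubgroup n)
      (conjH1 (κ.layerSubgroup n) ↥(AddSubgroup.torsionBy (Cofree ρ ↥(padicCoeffField S)) N) σ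
        (c : subgroupH1 (κ.layerSubgroup n) ↥(AddSubgroup.torsionBy (Cofree ρ ↥(padicCoeffField S)) N))) = 0 :=
  resOfLe_range_conjH1_eq_zero_of_res_shapiroLift_eq_zero S ρ N κ n hs hs1
    (NumberField.Place.Completion (Sum.inl w : NumberField.Place ℚ)) c h0 σ

end Local

/-! ## §4 `Ψ`-transports for an arbitrary finite discrete `M` with a non-degenerate pairing -/

section Psi

variable {M : Type} [AddCommGroup M] [TopologicalSpace M] [DiscreteTopology M] [Finite M]
  (ρM : DiscreteGaloisModule ℚ M) (N : ℕ) [NeZero N]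
  (e : M → M → AlgebraicClosure ℚ)
  (hμ : ∀ S T, e S T ^ N = 1)
  (hadd₁ : ∀ S₁ S₂ T, e (S₁ + S₂) T = e S₁ T * e S₂ T)
  (hadd₂ : ∀ S T₁ T₂, e S (T₁ + T₂) = e S T₁ * e S T₂)
  (hgal : ∀ (σ : absoluteGaloisGroup ℚ) (S T : M), σ • e S T = e (ρM σ S) (ρM σ T))
  (U : Subgroup (absoluteGaloisGroup ℚ)) (hU : IsOpen (U : Set (absoluteGaloisGroup ℚ))) [Fintype (absoluteGaloisGroup ℚ ⧸ U)]
  (hnondeg : ∀ T, (∀ S, e S T = 1) → T = 0) (hN : ∀ m : M, N • m = 0)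

include hnondeg hN in
/-- **`loc_w (H¹(Ψ) X) = 0 ⟹ loc_w X = 0`** at every place `w` of `ℚ`, for `X ∈ H¹(ℚ, Maps(Γ_ℚ ⧸ U, M))` and the summed duality
`Ψ = coindTateDualMor ρM ρM U (pairingHomOfFun …)`: localisation intertwines `H¹(Ψ)` with `H¹(Γ_{ℚ_w}, Ψ|)`, injective because `Ψ` is bijective
(`coindTateDualHom_bijective`, `CoindShapiroOfFun.bijective_pairingHomOfFun_flip`). [cite: MilneADT2006, Ch. I Cor. 2.3]
[cite: NeukirchSchmidtWingberg2008, I §5 (1.5.2)] -/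
theorem localization_eq_zero_of_localization_coindTateDual_eq_zero (w : Place ℚ)
    (X : galoisCohomology (ρM.coind U hU) 1)
    (hX : galoisCohomology.localization ((ρM.coind U hU).tateDual N) w 1
      (cohomologyMap (coindTateDualMor ρM ρM U (pairingHomOfFun N e hμ hadd₁ hadd₂) hU
          (fun σ S T => (contPairingOfFun ρM N e hμ hadd₁ hadd₂ hgal).toLin_smul σ S T)) 1 X) = 0) :
    galoisCohomology.localization (ρM.coind U hU) w 1 X = 0 := by
  rw [localization_cohomologyMap_coindTateDualMor] at hX
  haveI : DiscreteTopology (TopRep.res (absGaloisRestrict ℚ (Place.Completion w) :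
      absoluteGaloisGroup (Place.Completion w) →* absoluteGaloisGroup ℚ) (coindFin.{0, 0} ρM.toTopRep U)) :=
    inferInstanceAs (DiscreteTopology (absoluteGaloisGroup ℚ ⧸ U → M))
  haveI : DiscreteTopology (((ρM.coind U hU).tateDual N).toLocal w).toTopRep :=
    inferInstanceAs (DiscreteTopology (TateDual ℚ (absoluteGaloisGroup ℚ ⧸ U → M) N))
  have hinj := (bijective_cohomologyMap_of_bijective
    (TopRep.ofHom ⟨(coindTateDualMor ρM ρM U (pairingHomOfFun N e hμ hadd₁ hadd₂) hU
        (fun σ S T => (contPairingOfFun ρM N e hμ hadd₁ hadd₂ hgal).toLin_smul σ S T)).hom.toContinuousLinearMap, fun d =>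
      (coindTateDualMor ρM ρM U (pairingHomOfFun N e hμ hadd₁ hadd₂) hU
        (fun σ S T => (contPairingOfFun ρM N e hμ hadd₁ hadd₂ hgal).toLin_smul σ S T)).hom.isIntertwining'
          (absGaloisRestrict ℚ (Place.Completion w) d)⟩ :
      TopRep.res (absGaloisRestrict ℚ (Place.Completion w) : absoluteGaloisGroup (Place.Completion w) →* absoluteGaloisGroup ℚ)
        (coindFin.{0, 0} ρM.toTopRep U) ⟶ (((ρM.coind U hU).tateDual N).toLocal w).toTopRep)
    (coindTateDualHom_bijective U (pairingHomOfFun N e hμ hadd₁ hadd₂)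
      (CoindShapiroOfFun.bijective_pairingHomOfFun_flip N e hμ hadd₁ hadd₂ hnondeg hN)) 1).1
  exact hinj (hX.trans (map_zero _).symm)

include hnondeg hN in
/-- **`loc_w (H¹(Ψ) X) ∈ H¹_ur(ℚ_w, Maps^D) ⟹ loc_w X ∈ H¹_ur(ℚ_w, Maps)`** at a finite place `w`: restriction to `Γ_{ℚ_w^{ur}}` commutes with
`H¹(Ψ|)` and `H¹(Γ_{ℚ_w^{ur}}, Ψ)` is injective. [cite: MilneADT2006, Ch. I Thm. 2.6] [cite: NeukirchSchmidtWingberg2008, I §5 (1.5.2)] -/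
theorem localization_mem_unramifiedSubgroup_of_coindTateDual (w : HeightOneSpectrum (𝓞 ℚ))
    (X : galoisCohomology (ρM.coind U hU) 1)
    (hX : galoisCohomology.localization ((ρM.coind U hU).tateDual N) (Sum.inr w) 1
      (cohomologyMap (coindTateDualMor ρM ρM U (pairingHomOfFun N e hμ hadd₁ hadd₂) hU
          (fun σ S T => (contPairingOfFun ρM N e hμ hadd₁ hadd₂ hgal).toLin_smul σ S T)) 1 X) ∈
        unramifiedSubgroup (GaloisRep.toLocal w ((ρM.coind U hU).tateDual N)) 1) :
    galoisCohomology.localization (ρM.coind U hU) (Sum.inr w) 1 X ∈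
      unramifiedSubgroup (GaloisRep.toLocal w (ρM.coind U hU)) 1 := by
  -- names
  let ρc := ρM.coind U hU
  let Ψ := coindTateDualMor ρM ρM U (pairingHomOfFun N e hμ hadd₁ hadd₂) hU
    (fun σ S T => (contPairingOfFun ρM N e hμ hadd₁ hadd₂ hgal).toLin_smul σ S T)
  let F := IsNonarchimedeanLocalField.maxUnramified (w.adicCompletion ℚ)
  -- the composite restriction `Γ_{F} → Γ_{ℚ_w} → Γ_ℚ`
  let θ : absoluteGaloisGroup F →ₜ* absoluteGaloisGroup ℚ :=
    (absGaloisRestrict ℚ (w.adicCompletion ℚ)).comp (absGaloisRestrict (w.adicCompletion ℚ) F)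
  -- `Ψ` restricted along `θ`
  let Ψθ : TopRep.res (θ : absoluteGaloisGroup F →* absoluteGaloisGroup ℚ) (coindFin.{0, 0} ρM.toTopRep U) ⟶
      ((GaloisRep.toLocal w (ρc.tateDual N)).restrictField F).toTopRep :=
    TopRep.ofHom ⟨Ψ.hom.toContinuousLinearMap, fun d => Ψ.hom.isIntertwining' (θ d)⟩
  replace hX := (mem_unramifiedSubgroup_iff _ _ _).mp hX
  refine (mem_unramifiedSubgroup_iff _ _ _).mpr ?_
  -- both restrictions read on cocycles
  obtain ⟨f, rfl⟩ := oneCocycleClass_surjective _ X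
  have key : galoisCohomology.res (GaloisRep.toLocal w (ρc.tateDual N)) F 1
      (galoisCohomology.localization (ρc.tateDual N) (Sum.inr w) 1 (cohomologyMap Ψ 1 (oneCocycleClass ρc.toTopRep f))) =
      cohomologyMap Ψθ 1 (ContinuousCohomology.map θ
        (𝟙 (TopRep.res (θ : absoluteGaloisGroup F →* absoluteGaloisGroup ℚ) (coindFin.{0, 0} ρM.toTopRep U)))
        1 (oneCocycleClass ρc.toTopRep f)) := by
    change ContinuousCohomology.map _ _ 1 (ContinuousCohomology.map _ _ 1 (ContinuousCohomology.map _ _ 1 (oneCocycleClass _ f))) =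
      ContinuousCohomology.map _ _ 1 (ContinuousCohomology.map _ _ 1 (oneCocycleClass _ f))
    erw [map_oneCocycleClass, map_oneCocycleClass, map_oneCocycleClass, map_oneCocycleClass, map_oneCocycleClass]
    rfl
  have hres0 : galoisCohomology.res (GaloisRep.toLocal w ρc) F 1
      (galoisCohomology.localization ρc (Sum.inr w) 1 (oneCocycleClass _ f)) =
      ContinuousCohomology.map θ
        (𝟙 (TopRep.res (θ : absoluteGaloisGroup F →* absoluteGaloisGroup ℚ) (coindFin.{0, 0} ρM.toTopRep U)))
        1 (oneCocycleClass ρc.toTopRep f) := by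
    change ContinuousCohomology.map _ _ 1 (ContinuousCohomology.map _ _ 1 (oneCocycleClass _ f)) =
      ContinuousCohomology.map _ _ 1 (oneCocycleClass _ f)
    erw [map_oneCocycleClass, map_oneCocycleClass, map_oneCocycleClass]
    rfl
  haveI : DiscreteTopology (TopRep.res (θ : absoluteGaloisGroup F →* absoluteGaloisGroup ℚ) (coindFin.{0, 0} ρM.toTopRep U)) :=
    inferInstanceAs (DiscreteTopology (absoluteGaloisGroup ℚ ⧸ U → M))
  haveI : DiscreteTopology ((GaloisRep.toLocal w (ρc.tateDual N)).restrictField F).toTopRep :=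
    inferInstanceAs (DiscreteTopology (TateDual ℚ (absoluteGaloisGroup ℚ ⧸ U → M) N))
  have hinj := (bijective_cohomologyMap_of_bijective Ψθ
    (coindTateDualHom_bijective U (pairingHomOfFun N e hμ hadd₁ hadd₂)
      (CoindShapiroOfFun.bijective_pairingHomOfFun_flip N e hμ hadd₁ hadd₂ hnondeg hN)) 1).1
  have hX2 : cohomologyMap Ψθ 1 (ContinuousCohomology.map θ
      (𝟙 (TopRep.res (θ : absoluteGaloisGroup F →* absoluteGaloisGroup ℚ) (coindFin.{0, 0} ρM.toTopRep U)))
      1 (oneCocycleClass ρc.toTopRep f)) = 0 := key ▸ hX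
  change galoisCohomology.res (GaloisRep.toLocal w ρc) F 1 _ = 0
  rw [hres0]
  exact hinj (hX2.trans (map_zero _).symm)

end Psi

end ThetaTransport.ShapiroTransport

end Summit.BirchSwinnertonDyer.BirchSwinnertonDyer.Theorems

end
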